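import Summits.ValiantsHypothesis.ValiantsHypothesis.Theorems.NewtonUnitEquationsTwoProductsTowerRecordSparse

/-!
# R13-coeff — ANY `ℓ` LEVELS: iterated sumsets + pigeonhole ⇒ the HEIGHT-FREE SPARSE-LEVEL RECORD LAW `a(ℓ) = 4ℓ²+10ℓ+16`

(6/6) Iterated sumsets `C·E` (`sumset`, `|C·E| ≤ (C+1)^{|E|}` via the box parametrisation `boxPhi`), the pigeonhole `slow_step` (some `C < C₀`
has `2m|Λ_{C+1}| < (2m+1)|Λ_C|` once `(2m)^{C₀}(C₀+1)^ℓ < (2m+1)^{C₀}`, `hnum` with `C₀ = 8ℓ²m²`), ★ `sparseLevelRecordCount`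
(`#records ≤ 64(n²·C₀^{2ℓ}+3)(m+1)2^{3m}`), `arith_levels`, ★★ `sparseLevelRecordLaw_holds (ℓ) (hℓ : 1 ≤ ℓ) : SparseLevelRecordLaw ℓ` — the height
`D` is only the box parameter and does NOT enter the bound.  In 5906's currency exactly while the number of levels is bounded.
Transplant (val-lit-p3 g18) of val-idea-37 g4's kernel-checked scratch `Cruxes/TwoProducts/TowerRecords_val_idea_37_g4.lean` (rev 3,
sha16 988768bd6d8db99a, ns `ValIdea37g4T`; val-idea-crit-8 g2 VERDICT #19 + addendum: KEEP «R13-coeff», by-name GO for a verbatim transplant);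
proofs verbatim by name, docstrings added, namespace = the tree's.  Helper on crux `stmt-ValiantsHypothesis-5906` (`TwoProducts`, line
`relation_ladder`); `--supports`, closes nothing by itself.  HONEST LABEL (crit-8 #19): COEFFICIENT-SIDE; the class rung it feeds (R13, dense
parallel towers on dissociated carriers) is a wider CLASS rung, inert as a hatch; F10's collinear digit towers NOT covered; `ResidualLawV24` ⟺
`PlanarCellBound`, the crux (stmt-5906), every `closes` binder and every summit statement UNMOVED; VP ≠ VNP is NOT proved.
Credit: mathematics and kernel proofs val-idea-37 g4; critic of record val-idea-crit-8 g2.  No instances, no notation, no named facts. [folklore]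
-/

set_option linter.dupNamespace false

noncomputable section

open Classical

namespace Summit.ValiantsHypothesis.ValiantsHypothesis.Theorems.NewtonUnitEquations.TwoProducts.TowerRecord

open scoped BigOperators
open Module Polynomial
open Summit.ValiantsHypothesis.ValiantsHypothesis.Theorems.NewtonUnitEquations.TwoProducts.FormalLogLinearisation
open Summit.ValiantsHypothesis.ValiantsHypothesis.Theorems.NewtonUnitEquations.TwoProducts.MomentRecord
open Summit.ValiantsHypothesis.ValiantsHypothesis.Theorems.NewtonUnitEquations.TwoProducts.PlanarCell

variable {m n : ℕ}

section LevelsFile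
open Pointwise

/-! ### 10b. ANY number `ℓ` of levels: iterated sumsets + pigeonhole ⇒ a HEIGHT-FREE count `64(n²·C₀^{2ℓ}+3)(m+1)2^{3m}`, `C₀ = 8ℓ²m²` -/

/-- Iterated sumset `C·E` (`0·E = {0}`). -/
def sumset (E : Finset ℕ) : ℕ → Finset ℕ
  | 0 => {0}
  | C + 1 => sumset E C + E

/-- Box parametrisation of `C·E`. -/
def boxPhi (E : Finset ℕ) (c : ↥E → ℕ) : ℕ := ∑ e : ↥E, c e * (e : ℕ)

/-- `C·E` lies in the image of the box `{c : E → ℕ | c ≤ C}` under `boxPhi`. [folklore] -/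
theorem sumset_subset_image (E : Finset ℕ) (C : ℕ) :
    sumset E C ⊆ (Fintype.piFinset fun _ : ↥E => Finset.range (C + 1)).image (boxPhi E) := by
  induction C with
  | zero =>
    intro u hu
    simp only [sumset, Finset.mem_singleton] at hu
    subst hu
    refine Finset.mem_image.mpr ⟨fun _ => 0, ?_, ?_⟩
    · rw [Fintype.mem_piFinset]
      intro _
      exact Finset.mem_range.mpr (by omega)
    · simp [boxPhi]
  | succ C ih =>
    intro u hu
    simp only [sumset] at hu
    rw [Finset.mem_add] at hu
    obtain ⟨v, hv, e, he, rfl⟩ := hu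
    obtain ⟨c, hc, rfl⟩ := Finset.mem_image.mp (ih hv)
    rw [Fintype.mem_piFinset] at hc
    refine Finset.mem_image.mpr ⟨c + Pi.single (⟨e, he⟩ : ↥E) 1, ?_, ?_⟩
    · rw [Fintype.mem_piFinset]
      intro i
      have := Finset.mem_range.mp (hc i)
      rw [Finset.mem_range, Pi.add_apply]
      by_cases hi : i = ⟨e, he⟩
      · subst hi
        rw [Pi.single_eq_same]
        omega
      · rw [Pi.single_eq_of_ne hi]
        omega
    · simp only [boxPhi, Pi.add_apply, add_mul, Finset.sum_add_distrib]
      congr 1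
      rw [Finset.sum_eq_single (⟨e, he⟩ : ↥E)]
      · rw [Pi.single_eq_same, one_mul]
      · intro i _ hi
        rw [Pi.single_eq_of_ne hi, zero_mul]
      · intro h
        exact absurd (Finset.mem_univ _) h

/-- `|C·E| ≤ (C+1)^{|E|}`. [folklore] -/
theorem card_sumset_le (E : Finset ℕ) (C : ℕ) : (sumset E C).card ≤ (C + 1) ^ E.card := by
  refine (Finset.card_le_card (sumset_subset_image E C)).trans (Finset.card_image_le.trans (le_of_eq ?_))
  rw [Fintype.card_piFinset, Finset.prod_const, Finset.card_range, Finset.card_univ, Fintype.card_coe]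

/-- Pigeonhole: polynomial growth forces a slow step before `C₀` once `(2m)^{C₀}(C₀+1)^ℓ < (2m+1)^{C₀}`. -/
theorem slow_step (E : Finset ℕ) (m C₀ ℓ : ℕ) (hE : E.card ≤ ℓ)
    (hnum : (2 * m) ^ C₀ * (C₀ + 1) ^ ℓ < (2 * m + 1) ^ C₀) :
    ∃ C, C < C₀ ∧ 2 * m * (sumset E (C + 1)).card < (2 * m + 1) * (sumset E C).card := by
  by_contra h
  push Not at h
  have key : ∀ C, C ≤ C₀ → (2 * m + 1) ^ C ≤ (2 * m) ^ C * (sumset E C).card := by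
    intro C
    induction C with
    | zero =>
      intro _
      simp [sumset]
    | succ C ih =>
      intro hC
      have h1 := ih (by omega)
      have h2 := h C (by omega)
      calc (2 * m + 1) ^ (C + 1) = (2 * m + 1) ^ C * (2 * m + 1) := pow_succ _ _
        _ ≤ (2 * m) ^ C * (sumset E C).card * (2 * m + 1) := Nat.mul_le_mul_right _ h1
        _ = (2 * m) ^ C * ((2 * m + 1) * (sumset E C).card) := by ring
        _ ≤ (2 * m) ^ C * (2 * m * (sumset E (C + 1)).card) := Nat.mul_le_mul_left _ h2
        _ = (2 * m) ^ (C + 1) * (sumset E (C + 1)).card := by ring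
  have hc : (sumset E C₀).card ≤ (C₀ + 1) ^ ℓ :=
    (card_sumset_le E C₀).trans (Nat.pow_le_pow_right (by omega) hE)
  have := (key C₀ le_rfl).trans (Nat.mul_le_mul_left _ hc)
  omega

/-- `a^{j+1} + (j+1)a^j ≤ (a+1)^{j+1}` (two binomial terms). [folklore] -/
theorem pow_add_mul_le (a : ℕ) : ∀ j : ℕ, a ^ (j + 1) + (j + 1) * a ^ j ≤ (a + 1) ^ (j + 1)
  | 0 => by simp
  | j + 1 => by
    have ih := pow_add_mul_le a j
    have e : (a ^ (j + 1) + (j + 1) * a ^ j) * (a + 1) = a ^ (j + 2) + (j + 2) * a ^ (j + 1) + (j + 1) * a ^ j := by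
      ring
    calc a ^ (j + 1 + 1) + (j + 1 + 1) * a ^ (j + 1) ≤ (a ^ (j + 1) + (j + 1) * a ^ j) * (a + 1) := by
          rw [e]; exact Nat.le_add_right _ _
      _ ≤ (a + 1) ^ (j + 1) * (a + 1) := Nat.mul_le_mul_right _ ih
      _ = (a + 1) ^ (j + 1 + 1) := (pow_succ _ _).symm

/-- `2(2m)^{2m} ≤ (2m+1)^{2m}` for `m ≥ 1`. [folklore] -/
theorem two_mul_pow_le (m : ℕ) (hm : 1 ≤ m) : 2 * (2 * m) ^ (2 * m) ≤ (2 * m + 1) ^ (2 * m) := by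
  obtain ⟨j, hj⟩ : ∃ j, 2 * m = j + 1 := ⟨2 * m - 1, by omega⟩
  rw [hj]
  have h := pow_add_mul_le (j + 1) j
  have e : (j + 1) * (j + 1) ^ j = (j + 1) ^ (j + 1) := (pow_succ' _ _).symm
  rw [e] at h
  omega

/-- `8y² + 1 < 16^y` for `y ≥ 1`. [folklore] -/
theorem sixteen_pow_gt (y : ℕ) (hy : 1 ≤ y) : 8 * y ^ 2 + 1 < 16 ^ y := by
  induction y, hy using Nat.le_induction with
  | base => norm_num
  | succ y hy ih =>
    have : 8 * (y + 1) ^ 2 + 1 ≤ 16 * (8 * y ^ 2 + 1) := by nlinarith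
    calc 8 * (y + 1) ^ 2 + 1 ≤ 16 * (8 * y ^ 2 + 1) := this
      _ < 16 * 16 ^ y := Nat.mul_lt_mul_of_pos_left ih (by norm_num)
      _ = 16 ^ (y + 1) := (pow_succ' _ _).symm

/-- The numeric input of the pigeonhole with `C₀ = 2m·(4ℓ²m) = 8ℓ²m²`. -/
theorem hnum (m ℓ : ℕ) (hm : 1 ≤ m) (hℓ : 1 ≤ ℓ) :
    (2 * m) ^ (2 * m * (4 * ℓ * ℓ * m)) * (2 * m * (4 * ℓ * ℓ * m) + 1) ^ ℓ < (2 * m + 1) ^ (2 * m * (4 * ℓ * ℓ * m)) := by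
  set N := 4 * ℓ * ℓ * m with hN
  clear_value N
  have h1 : 2 ^ N * (2 * m) ^ (2 * m * N) ≤ (2 * m + 1) ^ (2 * m * N) := by
    have e1 : (2 * m) ^ (2 * m * N) = ((2 * m) ^ (2 * m)) ^ N := pow_mul _ _ _
    have e2 : (2 * m + 1) ^ (2 * m * N) = ((2 * m + 1) ^ (2 * m)) ^ N := pow_mul _ _ _
    rw [e1, e2, ← mul_pow]
    exact Nat.pow_le_pow_left (two_mul_pow_le m hm) N
  have h2 : (2 * m * N + 1) ^ ℓ < 2 ^ N := by
    have e1 : 2 * m * N + 1 = 8 * (ℓ * m) ^ 2 + 1 := by rw [hN]; ring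
    have e2 : 2 ^ N = (16 ^ (ℓ * m)) ^ ℓ := by
      rw [hN, ← pow_mul, show (16 : ℕ) = 2 ^ 4 by norm_num, ← pow_mul]
      congr 1
      ring
    rw [e1, e2]
    exact Nat.pow_lt_pow_left (sixteen_pow_gt (ℓ * m) (Nat.one_le_iff_ne_zero.mpr (by positivity))) (by omega)
  have hpos : 0 < (2 * m) ^ (2 * m * N) := by positivity
  calc (2 * m) ^ (2 * m * N) * (2 * m * N + 1) ^ ℓ < (2 * m) ^ (2 * m * N) * 2 ^ N :=
        Nat.mul_lt_mul_of_pos_left h2 hpos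
    _ = 2 ^ N * (2 * m) ^ (2 * m * N) := mul_comm _ _
    _ ≤ (2 * m + 1) ^ (2 * m * N) := h1

/-- **SPARSE-LEVEL RECORD COUNT** (any `ℓ ≥ |E|` levels, any height): `#records ≤ 64(n²·C₀^{2ℓ}+3)(m+1)2^{3m}`, `C₀ = 8ℓ²m²`. -/
theorem sparseLevelRecordCount (m n D ℓ : ℕ) (hm : 1 ≤ m) (hℓ : 1 ≤ ℓ) (γ γ' : Fin m → Fin n → ℂ[X])
    (hγD : DegLe γ D) (hγ'D : DegLe γ' D) (E : Finset ℕ) (hE : E.card ≤ ℓ)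
    (hγ : LevelsIn γ E) (hγ' : LevelsIn γ' E) (x : Fin n → Expo) (d : Fin 2 → ℤ) :
    ((shallowPairsT n m D).filter fun p => ∃ ξ : Fin 2 → ℝ, IsRecordT γ γ' x d m ξ p).card
      ≤ 32 * (2 + n * n * ((2 * m * (4 * ℓ * ℓ * m)) ^ ℓ * (2 * m * (4 * ℓ * ℓ * m)) ^ ℓ) + 1)
        * (2 * ((m + 1) * 2 ^ (2 * m + m))) := by
  set C₀ := 2 * m * (4 * ℓ * ℓ * m) with hC₀
  obtain ⟨C, hC, hslow⟩ := slow_step E m C₀ ℓ hE (hnum m ℓ hm hℓ)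
  have hΛ : 2 * m * (sumset E C + E).card < (2 * m + 1) * (sumset E C).card := hslow
  let J : Finset ℤ := (sumset E C ×ˢ sumset E C).image fun uv => ((uv.1 : ℕ) : ℤ) - ((uv.2 : ℕ) : ℤ)
  have hJ : ∀ u ∈ sumset E C, ∀ v ∈ sumset E C, ((u : ℤ) - v) ∈ J := fun u hu v hv =>
    Finset.mem_image.mpr ⟨(u, v), Finset.mem_product.mpr ⟨hu, hv⟩, rfl⟩
  have hC₀pos : 1 ≤ C₀ := by
    rw [hC₀]
    exact Nat.one_le_iff_ne_zero.mpr (by positivity)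
  have hΛc : (sumset E C).card ≤ C₀ ^ ℓ :=
    (card_sumset_le E C).trans
      ((Nat.pow_le_pow_left (by omega) _).trans (Nat.pow_le_pow_right hC₀pos hE))
  have hJc : J.card ≤ C₀ ^ ℓ * C₀ ^ ℓ := Finset.card_image_le.trans (by
    rw [Finset.card_product]
    exact Nat.mul_le_mul hΛc hΛc)
  refine (towerRecordCountG m n D γ γ' hγD hγ'D E (sumset E C) hγ hγ' hΛ J hJ x d).trans ?_
  have : 2 + n * n * J.card + 1 ≤ 2 + n * n * (C₀ ^ ℓ * C₀ ^ ℓ) + 1 := by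
    have := Nat.mul_le_mul_left (n * n) hJc
    omega
  exact Nat.mul_le_mul (Nat.mul_le_mul_left _ this) le_rfl

/-- Arithmetic: the sparse-level count is `≤ 2^{(4ℓ²+10ℓ+16) m}(t+2)²` for `n ≤ 2mt`. [folklore] -/
theorem arith_levels (m n t ℓ : ℕ) (hm : 1 ≤ m) (_hℓ : 1 ≤ ℓ) (hn : n ≤ 2 * m * t) :
    32 * (2 + n * n * ((2 * m * (4 * ℓ * ℓ * m)) ^ ℓ * (2 * m * (4 * ℓ * ℓ * m)) ^ ℓ) + 1)
        * (2 * ((m + 1) * 2 ^ (2 * m + m)))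
      ≤ 2 ^ ((2 * ((2 * ℓ + 5) * ℓ) + 16) * m) * (t + 2) ^ 2 := by
  obtain ⟨X, hX⟩ : ∃ X : ℕ, X = 2 ^ m := ⟨_, rfl⟩
  have hmX : m + 1 ≤ X := hX ▸ Nat.lt_two_pow_self
  have hX2 : 2 ≤ X := by
    rw [hX]
    calc (2 : ℕ) = 2 ^ 1 := (pow_one 2).symm
      _ ≤ 2 ^ m := Nat.pow_le_pow_right (by norm_num) hm
  have h3 : 2 ^ (2 * m + m) = X ^ 3 := by
    rw [hX, ← pow_mul]
    ring_nf
  have hA : 2 ^ ((2 * ((2 * ℓ + 5) * ℓ) + 16) * m) = X ^ (2 * ((2 * ℓ + 5) * ℓ) + 16) := by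
    rw [hX, ← pow_mul, mul_comm]
  rw [h3, hA]
  -- `C₀ ≤ X^{2ℓ+5}`
  have hℓX : ℓ * ℓ ≤ X ^ (2 * ℓ) := by
    have h1 : ℓ ≤ 2 ^ ℓ := Nat.lt_two_pow_self.le
    calc ℓ * ℓ ≤ 2 ^ ℓ * 2 ^ ℓ := Nat.mul_le_mul h1 h1
      _ = 2 ^ (2 * ℓ) := by rw [← pow_add]; ring_nf
      _ ≤ X ^ (2 * ℓ) := Nat.pow_le_pow_left hX2 _
  have hC₀ : 2 * m * (4 * ℓ * ℓ * m) ≤ X ^ (2 * ℓ + 5) := by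
    calc 2 * m * (4 * ℓ * ℓ * m) = 8 * (ℓ * ℓ) * (m * m) := by ring
      _ ≤ X ^ 3 * X ^ (2 * ℓ) * (X * X) := Nat.mul_le_mul (Nat.mul_le_mul
          (by calc (8:ℕ) = 2 ^ 3 := by norm_num
                _ ≤ X ^ 3 := Nat.pow_le_pow_left hX2 3) hℓX) (Nat.mul_le_mul (by omega) (by omega))
      _ = X ^ (2 * ℓ + 5) := by ring
  have hP : (2 * m * (4 * ℓ * ℓ * m)) ^ ℓ * (2 * m * (4 * ℓ * ℓ * m)) ^ ℓ ≤ X ^ (2 * ((2 * ℓ + 5) * ℓ)) := by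
    calc _ ≤ (X ^ (2 * ℓ + 5)) ^ ℓ * (X ^ (2 * ℓ + 5)) ^ ℓ :=
          Nat.mul_le_mul (Nat.pow_le_pow_left hC₀ _) (Nat.pow_le_pow_left hC₀ _)
      _ = X ^ (2 * ((2 * ℓ + 5) * ℓ)) := by rw [← pow_mul, ← pow_add]; ring_nf
  have hn' : n ≤ 2 * X * (t + 2) := by
    calc n ≤ 2 * m * t := hn
      _ ≤ 2 * X * (t + 2) := Nat.mul_le_mul (Nat.mul_le_mul_left 2 (by omega)) (by omega)
  have hnn : n * n ≤ X ^ 4 * (t + 2) ^ 2 := by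
    calc n * n ≤ (2 * X * (t + 2)) * (2 * X * (t + 2)) := Nat.mul_le_mul hn' hn'
      _ = 4 * X ^ 2 * (t + 2) ^ 2 := by ring
      _ ≤ X ^ 2 * X ^ 2 * (t + 2) ^ 2 := Nat.mul_le_mul_right _ (Nat.mul_le_mul_right _
          (by calc (4:ℕ) = 2 ^ 2 := by norm_num
                _ ≤ X ^ 2 := Nat.pow_le_pow_left hX2 2))
      _ = X ^ 4 * (t + 2) ^ 2 := by ring
  set P := (2 * m * (4 * ℓ * ℓ * m)) ^ ℓ * (2 * m * (4 * ℓ * ℓ * m)) ^ ℓ with hPdef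
  set K := 2 * ((2 * ℓ + 5) * ℓ) with hK
  have hQ : 1 ≤ X ^ 4 * (t + 2) ^ 2 * X ^ K := Nat.one_le_iff_ne_zero.mpr (by positivity)
  have hB : 2 + n * n * P + 1 ≤ X ^ 2 * (X ^ 4 * (t + 2) ^ 2 * X ^ K) := by
    have h1 : n * n * P ≤ X ^ 4 * (t + 2) ^ 2 * X ^ K := Nat.mul_le_mul hnn hP
    have h4 : 4 ≤ X ^ 2 := by
      calc (4:ℕ) = 2 ^ 2 := by norm_num
        _ ≤ X ^ 2 := Nat.pow_le_pow_left hX2 2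
    calc 2 + n * n * P + 1 ≤ 4 * (X ^ 4 * (t + 2) ^ 2 * X ^ K) := by omega
      _ ≤ X ^ 2 * (X ^ 4 * (t + 2) ^ 2 * X ^ K) := Nat.mul_le_mul_right _ h4
  have hC : 2 * ((m + 1) * X ^ 3) ≤ X * (X * X ^ 3) :=
    Nat.mul_le_mul (by omega) (Nat.mul_le_mul_right _ hmX)
  have h32 : 32 ≤ X ^ 5 := by
    calc (32:ℕ) = 2 ^ 5 := by norm_num
      _ ≤ X ^ 5 := Nat.pow_le_pow_left hX2 5
  calc 32 * (2 + n * n * P + 1) * (2 * ((m + 1) * X ^ 3))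
      ≤ X ^ 5 * (X ^ 2 * (X ^ 4 * (t + 2) ^ 2 * X ^ K)) * (X * (X * X ^ 3)) :=
        Nat.mul_le_mul (Nat.mul_le_mul h32 hB) hC
    _ = X ^ (K + 16) * (t + 2) ^ 2 := by ring

/-- **THE SPARSE-LEVEL RECORD LAW, PROVED** — `a(ℓ) = 4ℓ² + 10ℓ + 16`, `b = 2`, uniformly in the height. -/
theorem sparseLevelRecordLaw_holds (ℓ : ℕ) (hℓ : 1 ≤ ℓ) : SparseLevelRecordLaw ℓ := by
  refine ⟨2 * ((2 * ℓ + 5) * ℓ) + 16, 2, fun m n t D γ γ' x d E hE hγ hγ' hγD hγ'D hn => ?_⟩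
  rcases Nat.eq_zero_or_pos m with rfl | hm
  · have h0 : ((shallowPairsT n 0 D).filter fun p => ∃ ξ : Fin 2 → ℝ, IsRecordT γ γ' x d 0 ξ p).card = 0 := by
      rw [Finset.card_eq_zero, Finset.filter_eq_empty_iff]
      rintro p - ⟨ξ, hrec⟩
      have h := hrec.1
      simp only [liveT, Set.mem_setOf_eq, layerT, momentPolyT] at h
      exact h.2 (by simp)
    rw [h0]
    exact Nat.zero_le _
  exact (sparseLevelRecordCount m n D ℓ hm hℓ γ γ' hγD hγ'D E hE hγ hγ' x d).trans (arith_levels m n t ℓ hm hℓ hn)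


end LevelsFile

end Summit.ValiantsHypothesis.ValiantsHypothesis.Theorems.NewtonUnitEquations.TwoProducts.TowerRecord

end
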